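import Literature.NumberTheory.Weil1964.ThetaWeightForms
import Literature.NumberTheory.Automorphic.WeightFormsArchRestriction
import HarnessLib

/-!
# Theta forms under rational translation: left translates downstairs are Hecke translates upstairs

Reproduction (Literature): kernel-checked consequences of the definitions of
`Literature.NumberTheory.Automorphic.WeightForms(ArchRestriction)` and
`Literature.NumberTheory.Weil1964.ThetaWeightForms`; no new axioms, no records, nothing cited as a fact.

The dictionary `𝒜(G(F)\G(𝔸_F)/K_f)_τ = ⊕ᵢ 𝒜(Γᵢ\G(F_∞))_τ` (Borel 1997 §5, Getz–Hahn §6.3) reads an adelic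
weight form `F` on the identity double coset as the classical form `x ↦ F(ι_∞ x)` for the arithmetic group
`Δ` (`WeightForms.restrictHom`).  A RATIONAL element `γ ∈ G(F)` with archimedean component `γ₁` and finite
component `k` (abstractly: `ι γ₁ · k ∈ ΓU` with `k` centralising `ι(G₁)`, the hypotheses of
`WeightForms.comp_leftTranslate_eq`) acts DOWNSTAIRS by left translation `f ↦ (x ↦ f (γ₁ x))`, carrying
forms for `Δ` to forms for any `Δ'` with `γ₁ Δ' γ₁⁻¹ ⊆ Δ`, and UPSTAIRS by the Hecke translate
`F ↦ (g ↦ F (g k⁻¹))` (`ThetaKernelDatum.rightTranslateHom κ κ' η k⁻¹`, level moved to the conjugate):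
the two agree through restriction (`restrictHom_eq_leftTranslateHom_restrictHom`).  Since Hecke translates of
theta forms are theta forms (`ThetaKernelDatum.rightTranslateHom_thetaForm`, Weil's `R(g) θ(φ) = θ(ω(g) φ)`),
the RESTRICTED theta spaces are stable under rational left translation with the level moved:

* Part A (`WeightForms`, pure group bookkeeping): `leftTranslate_mem_weightForms`, `leftTranslateHom`;
  the conjugated weight group `κₖ c = k⁻¹ κ(c) k` is weight-matched (`isWeightMatched_of_conj`) and
  level-corrected for every `Δ'` with `γ₁ Δ' γ₁⁻¹ ⊆ Δ` (`isLevelCorrected_of_conj`); the compatibility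
  `κₖ c · k⁻¹ = k⁻¹ κ(c)` (`conj_mul_inv_eq`); restriction intertwines `R(k⁻¹)` upstairs with left
  translation by `γ₁` downstairs (`coe_restrictHom_eq_leftTranslate_of_coe_eq`,
  `restrictHom_eq_leftTranslateHom_restrictHom`).
* Part B (`ThetaKernelDatum`): `map_rightTranslateHom_thetaForms_le` — the span of theta forms over a set
  `𝓙` of test families is carried by `R(h)` into the span over any `𝓙'` containing an `h`-translate of each
  member of `𝓙`; `map_leftTranslateHom_map_restrictHom_thetaForms_le` and
  `exists_mem_map_restrictHom_coe_eq_leftTranslate` — for `γ₁` rational, every restricted theta form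
  `x ↦ F(ι x)`, `F ∈ thetaForms 𝓙 𝓕`, has its left translate `x ↦ F(ι (γ₁ x))` among the restricted theta
  forms of `(κ', 𝓙')` at level `Δ'` (the form-level content of "Hecke translates of theta one-forms are
  theta one-forms", the hypothesis `hΘ` of
  `UnitaryBallQuotientDatum.exists_mem_thetaClasses_classLift_eq_translate_of_apply_eq`).

References (context only; every declaration below is proved): Borel, *Automorphic forms on SL₂(ℝ)*
(1997) §5; Getz–Hahn, *An introduction to automorphic representations* §6.3–6.4; Weil 1964 n° 39–41.
-/

open _root_.MeasureTheory Function Module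
open Literature.NumberTheory.Automorphic
open Literature.NumberTheory.Automorphic.WeightForms

/-! ## Part A. Weight forms: left translation on the component group, conjugated weight groups -/

namespace Literature.NumberTheory.Automorphic.WeightForms

variable {GU : Type*} [Group GU] {G₁ : Type*} [Group G₁]
variable {Kc : Type*} [Group Kc] {Kc' : Type*} [Group Kc'] {K₁ : Type*} [Group K₁]
variable {R : Type*} [CommRing R] {W : Type*} [AddCommGroup W] [Module R W]
variable {ΓU ΓU' : Subgroup GU} {κ κₖ : Kc →* GU} {κ' : Kc' →* GU}
variable {τ : Representation R Kc W} {τ' : Representation R Kc' W}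
variable (ι : G₁ →* GU) {Δ Δ' : Subgroup G₁} {κ₁ : K₁ →* G₁} {τ₁ : Representation R K₁ W}

/-- **Left translation by `γ₁ ∈ G₁` carries weight forms for `Δ` to weight forms for `Δ'`** whenever
`γ₁ Δ' γ₁⁻¹ ⊆ Δ` (e.g. `Δ' = γ₁⁻¹ Δ γ₁ ∩ Δ`): `f ↦ (x ↦ f (γ₁ x))`; the weight is untouched (right
equivariance commutes with left translation). [folklore] -/
theorem leftTranslate_mem_weightForms (γ₁ : G₁) (hΔ' : ∀ δ' ∈ Δ', γ₁ * δ' * γ₁⁻¹ ∈ Δ) {f : G₁ → W}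
    (hf : f ∈ weightForms Δ κ₁ τ₁) : (fun x => f (γ₁ * x)) ∈ weightForms Δ' κ₁ τ₁ := by
  refine ⟨fun δ' hδ' x => ?_, fun u x => ?_⟩
  · show f (γ₁ * (δ' * x)) = f (γ₁ * x)
    have key : γ₁ * (δ' * x) = (γ₁ * δ' * γ₁⁻¹) * (γ₁ * x) := by group
    rw [key, hf.1 _ (hΔ' δ' hδ')]
  · show f (γ₁ * (x * κ₁ u)) = τ₁ u⁻¹ (f (γ₁ * x))
    rw [← mul_assoc, hf.2 u (γ₁ * x)]

/-- **Left translation as a linear map** `weightForms Δ κ₁ τ₁ →ₗ[R] weightForms Δ' κ₁ τ₁`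
(`γ₁ Δ' γ₁⁻¹ ⊆ Δ`). [folklore] -/
def leftTranslateHom (γ₁ : G₁) (hΔ' : ∀ δ' ∈ Δ', γ₁ * δ' * γ₁⁻¹ ∈ Δ) :
    weightForms Δ κ₁ τ₁ →ₗ[R] weightForms Δ' κ₁ τ₁ where
  toFun f := ⟨fun x => (f : G₁ → W) (γ₁ * x), leftTranslate_mem_weightForms γ₁ hΔ' f.2⟩
  map_add' _ _ := rfl
  map_smul' _ _ := rfl

/-- `leftTranslateHom` on points. [folklore] -/
@[simp] theorem leftTranslateHom_apply (γ₁ : G₁) (hΔ' : ∀ δ' ∈ Δ', γ₁ * δ' * γ₁⁻¹ ∈ Δ)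
    (f : weightForms Δ κ₁ τ₁) (x : G₁) :
    (leftTranslateHom (κ₁ := κ₁) (τ₁ := τ₁) γ₁ hΔ' f : G₁ → W) x = (f : G₁ → W) (γ₁ * x) := rfl

/-- `leftTranslateHom` as a function. [folklore] -/
theorem coe_leftTranslateHom (γ₁ : G₁) (hΔ' : ∀ δ' ∈ Δ', γ₁ * δ' * γ₁⁻¹ ∈ Δ)
    (f : weightForms Δ κ₁ τ₁) :
    (leftTranslateHom (κ₁ := κ₁) (τ₁ := τ₁) γ₁ hΔ' f : G₁ → W) = fun x => (f : G₁ → W) (γ₁ * x) := rfl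

/-- The canonical level for a translate: `γ₁ Δ' γ₁⁻¹ ⊆ Δ` holds for `Δ' ≤ Δ.comap (conj γ₁)`, in
particular for `γ₁⁻¹ Δ γ₁` itself and for `Δ ⊓ γ₁⁻¹ Δ γ₁`. [folklore] -/
theorem conj_mem_of_le_comap {γ₁ : G₁} (h : Δ' ≤ Δ.comap (MulAut.conj γ₁).toMonoidHom) :
    ∀ δ' ∈ Δ', γ₁ * δ' * γ₁⁻¹ ∈ Δ :=
  fun δ' hδ' => by simpa [MulAut.conj_apply] using h hδ'

/-- **The conjugated weight group is weight-matched**: for `k` centralising `ι(G₁)` and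
`κₖ c = k⁻¹ κ(c) k`, `IsWeightMatched κ τ ι κ₁ τ₁ η₁ ⇒ IsWeightMatched κₖ τ ι κ₁ τ₁ η₁` (the archimedean
weight does not see a finite-adelic conjugation). [folklore] -/
theorem isWeightMatched_of_conj {η₁ : K₁ →* Kc} (hη : IsWeightMatched κ τ ι κ₁ τ₁ η₁) {k : GU}
    (hk : ∀ x : G₁, Commute k (ι x)) (hκₖ : ∀ c : Kc, κₖ c = k⁻¹ * κ c * k) :
    IsWeightMatched κₖ τ ι κ₁ τ₁ η₁ := by
  refine ⟨fun u => ?_, hη.2⟩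
  rw [hκₖ, hη.1 u, mul_assoc, ← (hk (κ₁ u)).eq, inv_mul_cancel_left]

/-- **The conjugated weight group is level-corrected at the translated level**: if `Δ` is level-corrected
for `(ΓU, κ)` along `ι`, `γ = ι γ₁ · k ∈ ΓU` is rational with `k` centralising `ι(G₁)`, and
`κₖ c = k⁻¹ κ(c) k`, then every `Δ'` with `γ₁ Δ' γ₁⁻¹ ⊆ Δ` is level-corrected for `(ΓU, κₖ)`:
for `δ' ∈ Δ'` the correction of `δ = γ₁ δ' γ₁⁻¹` serves, since `ι δ' · κₖ c = γ⁻¹ (ι δ · κ c) γ ∈ ΓU`.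
[folklore] -/
theorem isLevelCorrected_of_conj (hΔ : IsLevelCorrected ΓU κ τ ι Δ) {γ₁ : G₁} {k : GU}
    (hγ : ι γ₁ * k ∈ ΓU) (hk : ∀ x : G₁, Commute k (ι x))
    (hκₖ : ∀ c : Kc, κₖ c = k⁻¹ * κ c * k) (hΔ' : ∀ δ' ∈ Δ', γ₁ * δ' * γ₁⁻¹ ∈ Δ) :
    IsLevelCorrected ΓU κₖ τ ι Δ' := by
  intro δ' hδ'
  obtain ⟨c, hc1, hmem, hcomm⟩ := hΔ _ (hΔ' δ' hδ')
  refine ⟨c, hc1, ?_, fun x => ?_⟩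
  · have e1 : ∀ y : GU, k⁻¹ * (ι δ' * y) = ι δ' * (k⁻¹ * y) := fun y => by
      rw [← mul_assoc, (hk δ').inv_left.eq, mul_assoc]
    have e2 : ∀ y : GU, κ c * (ι γ₁ * y) = ι γ₁ * (κ c * y) := fun y => by
      rw [← mul_assoc, (hcomm γ₁).eq, mul_assoc]
    have key : ι δ' * κₖ c = (ι γ₁ * k)⁻¹ * (ι (γ₁ * δ' * γ₁⁻¹) * κ c) * (ι γ₁ * k) := by
      simp only [hκₖ, map_mul, map_inv, mul_inv_rev, mul_assoc, inv_mul_cancel_left, e2, e1]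
    rw [key]
    exact ΓU.mul_mem (ΓU.mul_mem (ΓU.inv_mem hγ) hmem) hγ
  · rw [hκₖ]
    exact ((hk x).inv_left.mul_left (hcomm x)).mul_left (hk x)

/-- The compatibility feeding `ThetaKernelDatum.rightTranslateHom κ κₖ (MonoidHom.id Kc) k⁻¹`:
`κₖ c · k⁻¹ = k⁻¹ · κ c`. [folklore] -/
theorem conj_mul_inv_eq {k : GU} (hκₖ : ∀ c : Kc, κₖ c = k⁻¹ * κ c * k) (c : Kc) :
    κₖ c * k⁻¹ = k⁻¹ * κ (MonoidHom.id Kc c) := by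
  rw [hκₖ, MonoidHom.id_apply, mul_inv_cancel_right]

/-- The canonical conjugated weight group `(conj k⁻¹) ∘ κ` satisfies `κₖ c = k⁻¹ κ(c) k`. [folklore] -/
theorem conj_comp_apply (k : GU) (c : Kc) :
    ((MulAut.conj k⁻¹).toMonoidHom.comp κ) c = k⁻¹ * κ c * k := by
  simp

/-- **Restriction intertwines the Hecke translate upstairs with left translation downstairs**: for
`γ = ι γ₁ · k ∈ ΓU` rational (`k` centralising `ι(G₁)`), a form `F` upstairs and ANY form `F'` (any
level `ΓU'`, any weight group `κ'`) with `F'(g) = F(g k⁻¹)`, the restriction of `F'` is the left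
translate by `γ₁` of the restriction of `F`: `F'(ι x) = F(ι x · k⁻¹) = F(ι (γ₁ x))`. [folklore] -/
theorem coe_restrictHom_eq_leftTranslate_of_coe_eq {hΔ : IsLevelCorrected ΓU κ τ ι Δ} {η₁ : K₁ →* Kc}
    {hη : IsWeightMatched κ τ ι κ₁ τ₁ η₁} {hΔ'' : IsLevelCorrected ΓU' κ' τ' ι Δ'} {η₁' : K₁ →* Kc'}
    {hη'' : IsWeightMatched κ' τ' ι κ₁ τ₁ η₁'} {F : weightForms ΓU κ τ} {F' : weightForms ΓU' κ' τ'}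
    {γ₁ : G₁} {k : GU} (hγ : ι γ₁ * k ∈ ΓU) (hk : ∀ x : G₁, Commute k (ι x))
    (hF' : (F' : GU → W) = fun g => (F : GU → W) (g * k⁻¹)) :
    (restrictHom ι hΔ'' hη'' F' : G₁ → W) = fun x => (restrictHom ι hΔ hη F : G₁ → W) (γ₁ * x) := by
  funext x
  rw [restrictHom_apply, restrictHom_apply, hF', comp_leftTranslate_eq_of_mem ι F.2 hγ hk x]

/-- The same as an identity in `weightForms Δ' κ₁ τ₁`: `restrictHom F' = leftTranslateHom γ₁ (restrictHom F)`.
[folklore] -/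
theorem restrictHom_eq_leftTranslateHom_restrictHom {hΔ : IsLevelCorrected ΓU κ τ ι Δ} {η₁ : K₁ →* Kc}
    {hη : IsWeightMatched κ τ ι κ₁ τ₁ η₁} {hΔ'' : IsLevelCorrected ΓU' κ' τ' ι Δ'} {η₁' : K₁ →* Kc'}
    {hη'' : IsWeightMatched κ' τ' ι κ₁ τ₁ η₁'} {F : weightForms ΓU κ τ} {F' : weightForms ΓU' κ' τ'}
    {γ₁ : G₁} {k : GU} (hγ : ι γ₁ * k ∈ ΓU) (hk : ∀ x : G₁, Commute k (ι x))
    (hΔ' : ∀ δ' ∈ Δ', γ₁ * δ' * γ₁⁻¹ ∈ Δ)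
    (hF' : (F' : GU → W) = fun g => (F : GU → W) (g * k⁻¹)) :
    restrictHom ι hΔ'' hη'' F' = leftTranslateHom γ₁ hΔ' (restrictHom ι hΔ hη F) :=
  Subtype.ext (coe_restrictHom_eq_leftTranslate_of_coe_eq ι (hΔ := hΔ) (hη := hη) (hΔ'' := hΔ'') (hη'' := hη'')
    hγ hk hF')

end Literature.NumberTheory.Automorphic.WeightForms

/-! ## Part B. Theta forms: Hecke translates of spans, and the restricted theta spaces -/

namespace Literature.NumberTheory.Weil1964.ThetaKernelDatum

universe u v

variable {Mp : Type u} {SX : Type v} [TopologicalSpace Mp] [Group Mp] [TopologicalSpace SX]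
variable {GU : Type*} [Group GU] [TopologicalSpace GU] [IsTopologicalGroup GU] {ΓU : Subgroup GU}
variable {G : Type*} [Group G] [TopologicalSpace G] [IsTopologicalGroup G] {Γ : Subgroup G}
variable (M : ThetaKernelDatum Mp SX GU ΓU G Γ)
variable {Kc : Type*} [Group Kc] (κ : Kc →* GU)
variable {Kc' : Type*} [Group Kc'] (κ' : Kc' →* GU) (η : Kc' →* Kc)
variable {W : Type*} [AddCommGroup W] [Module ℂ W] {τ : Representation ℂ Kc W}
  {τ' : Representation ℂ Kc' W}
variable [AddCommGroup SX] [Module ℂ SX]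
variable [CompactSpace (GU ⧸ ΓU)] [CompactSpace (G ⧸ Γ)] [MeasurableSpace (G ⧸ Γ)] [BorelSpace (G ⧸ Γ)]
  (μ : Measure (G ⧸ Γ)) [IsFiniteMeasure μ] (hlin : M.W.ThetaLinear)
variable {E : Type*} [AddCommGroup E] [Module ℂ E] {σ : Representation ℂ Kc E}
  {σ' : Representation ℂ Kc' E}
variable [IsReflexive ℂ W]
variable (ι : Dual ℂ W →ₗ[ℂ] E) (hι : ∀ (k : Kc) (ℓ : Dual ℂ W), ι (τ.dual k ℓ) = σ k (ι ℓ))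
  (hι' : ∀ (k' : Kc') (ℓ : Dual ℂ W), ι (τ'.dual k' ℓ) = σ' k' (ι ℓ))

/-- **Hecke translates of the space of theta forms**: if every test family in `𝓙` has an `h`-translate in
`𝓙'` (`Θ_{j'(e)}(S) = Θ_{j(e)}(S · s(h,1))`, e.g. `j' = ω(h,1) ∘ j`), then `R(h)` carries the span of the
theta forms over `(κ, σ, 𝓙)` into the span over `(κ', σ', 𝓙')` — `κ'(k') h = h κ(η k')`,
`τ'(k') = τ(η k')`, `σ'(k') = σ(η k')` — with the same weight functions `𝓕`. [folklore] -/
theorem map_rightTranslateHom_thetaForms_le {h : GU} (hh : ∀ k' : Kc', κ' k' * h = h * κ (η k'))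
    (hτ : ∀ k' : Kc', τ' k' = τ (η k')) (hσ : ∀ k' : Kc', σ' k' = σ (η k'))
    {𝓙 : Set {j : E →ₗ[ℂ] SX // M.IsThetaEquivariant κ σ j}}
    {𝓙' : Set {j' : E →ₗ[ℂ] SX // M.IsThetaEquivariant κ' σ' j'}}
    (hJ : ∀ j ∈ 𝓙, ∃ j' ∈ 𝓙', M.IsThetaTranslate h j.1 j'.1) (𝓕 : Set C(G ⧸ Γ, ℂ)) :
    (M.thetaForms μ hlin κ σ ι hι 𝓙 𝓕).map (rightTranslateHom κ κ' η h hh hτ) ≤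
      M.thetaForms μ hlin κ' σ' ι hι' 𝓙' 𝓕 := by
  unfold thetaForms
  rw [Submodule.map_span_le]
  rintro _ ⟨j, hj, f, hf, rfl⟩
  obtain ⟨j', hj', ht⟩ := hJ j hj
  rw [M.rightTranslateHom_thetaForm κ κ' η ι hι μ hlin hh hτ hσ j.2 ht f]
  exact M.thetaForm_mem_thetaForms μ hlin κ' σ' ι hι' hj' hf

variable {G₁ : Type*} [Group G₁] {K₁ : Type*} [Group K₁] (ιinf : G₁ →* GU)
  {Δ Δ' : Subgroup G₁} {κ₁ : K₁ →* G₁} {τ₁ : Representation ℂ K₁ W}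

/-- **Rational left translates of restricted theta forms are restricted theta forms, level moved.**
For `γ = ιinf γ₁ · k ∈ ΓU` rational (`k` centralising `ιinf(G₁)`), a level `Δ'` with `γ₁ Δ' γ₁⁻¹ ⊆ Δ`,
a weight group `κ'` with `κ'(k') k⁻¹ = k⁻¹ κ(η k')` (e.g. `κₖ = (conj k⁻¹) ∘ κ`, `η = id`,
`WeightForms.conj_mul_inv_eq`) level-corrected at `Δ'` (`WeightForms.isLevelCorrected_of_conj`) and
weight-matched (`WeightForms.isWeightMatched_of_conj`), and test families `𝓙'` containing a `k⁻¹`-translate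
of each member of `𝓙`: left translation by `γ₁` maps the restricted theta space of `(κ, 𝓙)` at level `Δ`
into the restricted theta space of `(κ', 𝓙')` at level `Δ'`. [folklore] -/
theorem map_leftTranslateHom_map_restrictHom_thetaForms_le
    {hΔ : IsLevelCorrected ΓU κ τ ιinf Δ} {η₁ : K₁ →* Kc} {hη : IsWeightMatched κ τ ιinf κ₁ τ₁ η₁}
    {hΔ'' : IsLevelCorrected ΓU κ' τ' ιinf Δ'} {η₁' : K₁ →* Kc'}
    {hη'' : IsWeightMatched κ' τ' ιinf κ₁ τ₁ η₁'}
    {γ₁ : G₁} {k : GU} (hγ : ιinf γ₁ * k ∈ ΓU) (hk : ∀ x : G₁, Commute k (ιinf x))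
    (hΔ' : ∀ δ' ∈ Δ', γ₁ * δ' * γ₁⁻¹ ∈ Δ)
    (hh : ∀ k' : Kc', κ' k' * k⁻¹ = k⁻¹ * κ (η k')) (hτ : ∀ k' : Kc', τ' k' = τ (η k'))
    (hσ : ∀ k' : Kc', σ' k' = σ (η k'))
    {𝓙 : Set {j : E →ₗ[ℂ] SX // M.IsThetaEquivariant κ σ j}}
    {𝓙' : Set {j' : E →ₗ[ℂ] SX // M.IsThetaEquivariant κ' σ' j'}}
    (hJ : ∀ j ∈ 𝓙, ∃ j' ∈ 𝓙', M.IsThetaTranslate k⁻¹ j.1 j'.1) (𝓕 : Set C(G ⧸ Γ, ℂ)) :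
    ((M.thetaForms μ hlin κ σ ι hι 𝓙 𝓕).map (restrictHom ιinf hΔ hη)).map
        (leftTranslateHom γ₁ hΔ') ≤
      (M.thetaForms μ hlin κ' σ' ι hι' 𝓙' 𝓕).map (restrictHom ιinf hΔ'' hη'') := by
  have hcomp : (leftTranslateHom (κ₁ := κ₁) (τ₁ := τ₁) γ₁ hΔ').comp (restrictHom ιinf hΔ hη) =
      (restrictHom ιinf hΔ'' hη'').comp (rightTranslateHom κ κ' η k⁻¹ hh hτ) :=
    LinearMap.ext fun F =>
      (restrictHom_eq_leftTranslateHom_restrictHom ιinf (hΔ := hΔ) (hη := hη) (hΔ'' := hΔ'')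
        (hη'' := hη'') hγ hk hΔ' (F := F) (F' := rightTranslateHom κ κ' η k⁻¹ hh hτ F) rfl).symm
  rw [← Submodule.map_comp, hcomp, Submodule.map_comp]
  exact Submodule.map_mono
    (M.map_rightTranslateHom_thetaForms_le κ κ' η μ hlin ι hι hι' hh hτ hσ hJ 𝓕)

/-- **The same, one form at a time** (the shape of the hypothesis `hΘ` of
`UnitaryBallQuotientDatum.exists_mem_thetaClasses_classLift_eq_translate_of_apply_eq` with `ιinf = id`
downstairs): every restricted theta form `F` of `(κ, 𝓙)` at level `Δ` has a restricted theta form `F'` of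
`(κ', 𝓙')` at level `Δ'` with `F'(x) = F(γ₁ x)`. [folklore] -/
theorem exists_mem_map_restrictHom_coe_eq_leftTranslate
    {hΔ : IsLevelCorrected ΓU κ τ ιinf Δ} {η₁ : K₁ →* Kc} {hη : IsWeightMatched κ τ ιinf κ₁ τ₁ η₁}
    {hΔ'' : IsLevelCorrected ΓU κ' τ' ιinf Δ'} {η₁' : K₁ →* Kc'}
    {hη'' : IsWeightMatched κ' τ' ιinf κ₁ τ₁ η₁'}
    {γ₁ : G₁} {k : GU} (hγ : ιinf γ₁ * k ∈ ΓU) (hk : ∀ x : G₁, Commute k (ιinf x))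
    (hΔ' : ∀ δ' ∈ Δ', γ₁ * δ' * γ₁⁻¹ ∈ Δ)
    (hh : ∀ k' : Kc', κ' k' * k⁻¹ = k⁻¹ * κ (η k')) (hτ : ∀ k' : Kc', τ' k' = τ (η k'))
    (hσ : ∀ k' : Kc', σ' k' = σ (η k'))
    {𝓙 : Set {j : E →ₗ[ℂ] SX // M.IsThetaEquivariant κ σ j}}
    {𝓙' : Set {j' : E →ₗ[ℂ] SX // M.IsThetaEquivariant κ' σ' j'}}
    (hJ : ∀ j ∈ 𝓙, ∃ j' ∈ 𝓙', M.IsThetaTranslate k⁻¹ j.1 j'.1) (𝓕 : Set C(G ⧸ Γ, ℂ))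
    {F : weightForms Δ κ₁ τ₁} (hF : F ∈ (M.thetaForms μ hlin κ σ ι hι 𝓙 𝓕).map (restrictHom ιinf hΔ hη)) :
    ∃ F' ∈ (M.thetaForms μ hlin κ' σ' ι hι' 𝓙' 𝓕).map (restrictHom ιinf hΔ'' hη''),
      (F' : G₁ → W) = fun x => (F : G₁ → W) (γ₁ * x) :=
  ⟨leftTranslateHom γ₁ hΔ' F,
    M.map_leftTranslateHom_map_restrictHom_thetaForms_le κ κ' η μ hlin ι hι hι' ιinf hγ hk hΔ' hh hτ hσ
      hJ 𝓕 (Submodule.mem_map_of_mem hF),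
    rfl⟩

end Literature.NumberTheory.Weil1964.ThetaKernelDatum
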